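import Summits.ABC.IUTFork.Conditional.WRowUnconditionalCellsBase
import HarnessLib

/-!
# R-W WINDOW-TABLE, unconditional triple socket (integer-slot variant) — base-multiple and end-label lemmas with the inner radius
# `ρin = max(1, ⌊e/q⌋)` bounded below linearly (pure arithmetic)

PROOF-ONLY file (D-0012; 0 definitions, 0 `Prop` facts; integer arithmetic only) of the abc-iut cell — D-0079 RESCUE sub-cell R-W «WINDOW Θ-SIDE
INEQUALITY», W1 ROW DECISIONS composer seat abc-iut-W-row-1 (gen 2), claim «W:INHABITED-BANDS-A». Companion of
`Summits/ABC/IUTFork/Cor312LicenceTripleUnconditionalSlot.lean` (the integer-slot variant of this seat's socket, whose inner-radius entry is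
`ρin = max(1, ⌊e/(p−1)⌋)` at EVERY odd bad prime — abc-iut-c312-5's slot witness holds in every `ℚ_p`-field, `p` odd). With `e = e₀·n` the slot
is not linear in `n`, but `⌊e₀n/q⌋ ≥ r·n` whenever `r·q ≤ e₀`; since the inner radius enters the cell with a negative sign, the floor-free cell with
`ρin` replaced by `r·n` dominates, and the base-multiple / end-label mechanism of `WRowUnconditionalCellsBase` goes through from any base multiple
`n₀` (the floor-free expression is `n·α + β` with `β ≥ 0`, so `α ≤ 0` once it is `≤ 0` at `n₀`, and then it is `≤ 0` at every `n ≥ n₀`):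
* `WRow.cell_tameslot_of_base` — tame shape `D = e − 1`, `ρin = max(1, ⌊e/q⌋)`, all `n ≥ n₀` from the floor-free cell at `e₀·n₀` with `r·n₀`;
* `WRow.cell_tameslot_of_ends` — and at all labels from the two end labels (convexity, `WRow.quad_nonpos_of_ends`).
Consumers: the Reyssat levels `l = 151, 157, 163` (`WRowReyssatSmallLevels.lean`), where the tame prime `23` needs the slot. HONEST SCOPE: integer
arithmetic only; nothing here bears on the printed inequality; no abc claim. [folklore]
-/

namespace Summit.ABC.IUTFork.Conditional

/-- **All multiples `n ≥ n₀` from the base multiple `n₀`, tame shape with the integer slot** (`D = e − 1`, `ρin = max(1, ⌊e/q⌋)`, `r·q ≤ e₀` so that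
`⌊e₀n/q⌋ ≥ r·n`, `P = e·h₂/l₂` with `l₂ ∣ e₀·h₂`): if the FLOOR-FREE cell with `ρin` replaced by `r·n₀` and the first envelope member holds at
`e₀·n₀`, the exact cell holds at every `e = e₀·n`, `n ≥ n₀`. [folklore] -/
theorem WRow.cell_tameslot_of_base (p : ℤ) (e₀ q r h₂ l₂ A B i n₀ : ℕ) (hp : 1 ≤ p) (hq0 : 0 < q) (hr : r * q ≤ e₀) (hl₂0 : 0 < l₂)
    (hl₂ : l₂ ∣ e₀ * h₂) (he₀ : 0 < e₀) (hn₀ : 1 ≤ n₀)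
    (hbase : ((i + 1 : ℕ) : ℤ) ^ 2 * (((e₀ * h₂ / l₂ : ℕ) : ℤ) * (n₀ : ℤ)) - ((i + 1 : ℕ) : ℤ) * ((e₀ : ℤ) * (n₀ : ℤ) - 1) -
        ((i + 2 : ℕ) : ℤ) * ((r : ℤ) * (n₀ : ℤ)) + ((i + 2 : ℕ) : ℤ) * (p ^ A - (A : ℤ) * ((e₀ : ℤ) * (n₀ : ℤ))) ≤
        ((e₀ * h₂ / l₂ : ℕ) : ℤ) * (n₀ : ℤ))
    {n : ℕ} (hn : n₀ ≤ n) :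
    ((e₀ * n : ℕ) : ℤ) * ((((i + 1 : ℕ) : ℤ) ^ 2 * ((e₀ * n * h₂ / l₂ : ℕ) : ℤ) - ((i + 1 : ℕ) : ℤ) * ((e₀ * n - 1 : ℕ) : ℤ) -
        ((i + 2 : ℕ) : ℤ) * (((max 1 (e₀ * n / q) : ℕ) : ℤ))) / ((e₀ * n : ℕ) : ℤ)) +
      ((i + 2 : ℕ) : ℤ) * min (p ^ A - (A : ℤ) * ((e₀ * n : ℕ) : ℤ)) (p ^ B - (B : ℤ) * ((e₀ * n : ℕ) : ℤ)) ≤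
      ((e₀ * n * h₂ / l₂ : ℕ) : ℤ) := by
  obtain ⟨k, hk⟩ := hl₂
  have hP0 : e₀ * h₂ / l₂ = k := by rw [hk, Nat.mul_div_cancel_left _ hl₂0]
  have hP : e₀ * n * h₂ / l₂ = k * n := by
    rw [show e₀ * n * h₂ = l₂ * (k * n) by rw [mul_right_comm, hk]; ring, Nat.mul_div_cancel_left _ hl₂0]
  have hn1 : 1 ≤ n := le_trans hn₀ hn
  have he : (0 : ℤ) < ((e₀ * n : ℕ) : ℤ) := by have : 0 < e₀ * n := Nat.mul_pos he₀ (by omega); exact_mod_cast this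
  have hsub : ((e₀ * n - 1 : ℕ) : ℤ) = (e₀ : ℤ) * (n : ℤ) - 1 := by
    rw [Nat.cast_sub (by nlinarith)]; push_cast; ring
  -- the slot is at least `r·n`
  have hslot : r * n ≤ max 1 (e₀ * n / q) := by
    refine le_trans ?_ (le_max_right _ _)
    rw [Nat.le_div_iff_mul_le hq0]
    calc r * n * q = r * q * n := by ring
      _ ≤ e₀ * n := Nat.mul_le_mul_right _ hr
  have hslot' : (r : ℤ) * (n : ℤ) ≤ (((max 1 (e₀ * n / q) : ℕ) : ℤ)) := by exact_mod_cast hslot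
  rw [hP0] at hbase
  rw [hP, hsub]
  have hfloor := Int.mul_ediv_self_le (k := ((e₀ * n : ℕ) : ℤ))
    (x := ((i + 1 : ℕ) : ℤ) ^ 2 * ((k * n : ℕ) : ℤ) - ((i + 1 : ℕ) : ℤ) * ((e₀ : ℤ) * (n : ℤ) - 1) -
      ((i + 2 : ℕ) : ℤ) * (((max 1 (e₀ * n / q) : ℕ) : ℤ))) he.ne'
  have hmin : min (p ^ A - (A : ℤ) * ((e₀ * n : ℕ) : ℤ)) (p ^ B - (B : ℤ) * ((e₀ * n : ℕ) : ℤ)) ≤ p ^ A - (A : ℤ) * ((e₀ * n : ℕ) : ℤ) :=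
    min_le_left _ _
  have hJ : (0 : ℤ) ≤ ((i + 2 : ℕ) : ℤ) := by positivity
  have hJm := mul_le_mul_of_nonneg_left hmin hJ
  have hJr := mul_le_mul_of_nonneg_left hslot' hJ
  have hpA : (1 : ℤ) ≤ p ^ A := one_le_pow₀ hp
  have h1 : (1 : ℤ) ≤ ((i + 1 : ℕ) : ℤ) := by exact_mod_cast (by omega : 1 ≤ i + 1)
  have hn₀' : (1 : ℤ) ≤ (n₀ : ℤ) := by exact_mod_cast hn₀
  have hn' : (n₀ : ℤ) ≤ (n : ℤ) := by exact_mod_cast hn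
  -- the coefficient `α` of the multiple and the constant `β ≥ 1`
  have hβ : (1 : ℤ) ≤ ((i + 1 : ℕ) : ℤ) + ((i + 2 : ℕ) : ℤ) * p ^ A := by nlinarith
  have hbase' : (n₀ : ℤ) * (((i + 1 : ℕ) : ℤ) ^ 2 * (k : ℤ) - ((i + 1 : ℕ) : ℤ) * (e₀ : ℤ) - ((i + 2 : ℕ) : ℤ) * (r : ℤ) -
      ((i + 2 : ℕ) : ℤ) * ((A : ℤ) * (e₀ : ℤ)) - (k : ℤ)) + (((i + 1 : ℕ) : ℤ) + ((i + 2 : ℕ) : ℤ) * p ^ A) ≤ 0 := by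
    push_cast at hbase ⊢
    linarith
  have hα : ((i + 1 : ℕ) : ℤ) ^ 2 * (k : ℤ) - ((i + 1 : ℕ) : ℤ) * (e₀ : ℤ) - ((i + 2 : ℕ) : ℤ) * (r : ℤ) -
      ((i + 2 : ℕ) : ℤ) * ((A : ℤ) * (e₀ : ℤ)) - (k : ℤ) ≤ 0 := by
    by_contra hc
    push Not at hc
    have := mul_pos (by linarith : (0 : ℤ) < (n₀ : ℤ)) hc
    linarith
  have hαN := mul_le_mul_of_nonpos_right hn' hα
  generalize (((max 1 (e₀ * n / q) : ℕ) : ℤ)) = ρ at hslot' hfloor hJr ⊢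
  push_cast at hfloor hJm hJr hαN hbase' ⊢
  linarith [hfloor, hJm, hJr, hαN, hbase']

/-- **Tame-slot cells for every admissible index from the TWO END LABELS at the base multiple `n₀`**: if the floor-free base cell of
`WRow.cell_tameslot_of_base` holds at `i = 0` and at `i = L − 1`, it holds at every `i < L` (convexity in the label), hence the exact cell at every
`e = e₀·n`, `n ≥ n₀`. [folklore] -/
theorem WRow.cell_tameslot_of_ends (p : ℤ) (e₀ q r h₂ l₂ A B L n₀ : ℕ) (hp : 1 ≤ p) (hq0 : 0 < q) (hr : r * q ≤ e₀) (hl₂0 : 0 < l₂)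
    (hl₂ : l₂ ∣ e₀ * h₂) (he₀ : 0 < e₀) (hn₀ : 1 ≤ n₀)
    (hends : ∀ i : ℕ, i = 0 ∨ i + 1 = L →
      ((i + 1 : ℕ) : ℤ) ^ 2 * (((e₀ * h₂ / l₂ : ℕ) : ℤ) * (n₀ : ℤ)) - ((i + 1 : ℕ) : ℤ) * ((e₀ : ℤ) * (n₀ : ℤ) - 1) -
        ((i + 2 : ℕ) : ℤ) * ((r : ℤ) * (n₀ : ℤ)) + ((i + 2 : ℕ) : ℤ) * (p ^ A - (A : ℤ) * ((e₀ : ℤ) * (n₀ : ℤ))) ≤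
        ((e₀ * h₂ / l₂ : ℕ) : ℤ) * (n₀ : ℤ))
    {i : ℕ} (hi : i < L) {n : ℕ} (hn : n₀ ≤ n) :
    ((e₀ * n : ℕ) : ℤ) * ((((i + 1 : ℕ) : ℤ) ^ 2 * ((e₀ * n * h₂ / l₂ : ℕ) : ℤ) - ((i + 1 : ℕ) : ℤ) * ((e₀ * n - 1 : ℕ) : ℤ) -
        ((i + 2 : ℕ) : ℤ) * (((max 1 (e₀ * n / q) : ℕ) : ℤ))) / ((e₀ * n : ℕ) : ℤ)) +
      ((i + 2 : ℕ) : ℤ) * min (p ^ A - (A : ℤ) * ((e₀ * n : ℕ) : ℤ)) (p ^ B - (B : ℤ) * ((e₀ * n : ℕ) : ℤ)) ≤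
      ((e₀ * n * h₂ / l₂ : ℕ) : ℤ) := by
  refine WRow.cell_tameslot_of_base p e₀ q r h₂ l₂ A B i n₀ hp hq0 hr hl₂0 hl₂ he₀ hn₀ ?_ hn
  have h1 := hends 0 (Or.inl rfl)
  have hL := hends (L - 1) (Or.inr (by omega))
  have hc1 : ((L - 1 + 1 : ℕ) : ℤ) = (L : ℤ) := by rw [Nat.sub_add_cancel (by omega)]
  have hc2 : ((L - 1 + 2 : ℕ) : ℤ) = (L : ℤ) + 1 := by
    rw [show L - 1 + 2 = L + 1 by omega]; push_cast; ring
  rw [hc1, hc2] at hL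
  have q := WRow.quad_nonpos_of_ends (((e₀ * h₂ / l₂ : ℕ) : ℤ) * (n₀ : ℤ))
    (-((e₀ : ℤ) * (n₀ : ℤ) - 1) - ((r : ℤ) * (n₀ : ℤ)) + (p ^ A - (A : ℤ) * ((e₀ : ℤ) * (n₀ : ℤ))))
    (-((r : ℤ) * (n₀ : ℤ)) + (p ^ A - (A : ℤ) * ((e₀ : ℤ) * (n₀ : ℤ))) - ((e₀ * h₂ / l₂ : ℕ) : ℤ) * (n₀ : ℤ)) L (by positivity)
    (by push_cast at h1 ⊢; linarith) (by linarith) (i + 1) (by omega) (by omega)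
  push_cast at q ⊢
  linarith

end Summit.ABC.IUTFork.Conditional
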